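import Summits.HodgeConjecture.HodgeConjecture.Theorems.K2LiuRankOneCosetCoverAnyPlace   -- ★ (F2a, this seat): `doubleCoset_subset_biUnion_cosets`; brings ★ (F1) `isCartanFamily_unitaryInt_two`
import Summits.HodgeConjecture.HodgeConjecture.Theorems.K2LiuAntifixedLatticeIndex        -- ★ (F2b, this seat): `exists_relIndex_antifixedBall_le`, `exists_net_of_relIndex_ne_zero`
import Summits.HodgeConjecture.HodgeConjecture.Theorems.K2LiuSplitCosetCount              -- ★ (K2Liu-p05): `isCartanFamily_of_mulEquiv`, `mem_doubleCoset_symm_iff`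
import Literature.NumberTheory.Automorphic.HyperspecialUnitaryCompactOpen                -- ★ `isCompact_unitaryInt_adicCompletion`, `isOpen_unitaryInt_adicCompletion`
import Literature.NumberTheory.Automorphic.UnitaryGroupFormTransport                     -- ★ `unitaryGroupOfFormCongrOfEq`
import Literature.NumberTheory.Automorphic.LocalUnitaryGroupCongr                        -- ★ `localPiNonsplitEquiv`
import Literature.NumberTheory.Automorphic.Liu2021.FinAdelicCheckSurjective              -- ★ `galAdicCompletionMap_galAdicCompletionMap_self`, `exists_galAdicCompletionMap_ne`
import Literature.NumberTheory.Automorphic.AdicCompletionCompact                         -- ★ `finite_residueField_adicCompletion`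

/-!
# The rank-one Cartan VOLUME DATUM of `G_v = U(diag dV)(L⁺_v)` at ANY non-split place with a RATIONAL hyperbolic frame (organ (26-r), volume + family)

Track B ∕ K2-LIT, hLiu418 = stmt-HodgeConjecture-24832; socket #32dR `sig_K2LiuDoublingHeightDecayLocalR2` (U5d ED. 5 :554) through ★
`doublingHeightDecayLocalR2_of_nonsplitData` (K2Liu-p04 g3).  LEAD F0P6-plan (g11) deal (26-r) → K2Liu-p04 (g4); REPORT-FIRST
`K2/K2Liu-p04/g4/REPORT-FIRST-26r-IsotropicAnyPlace.K2Liup04g4.md` (F4, first half).  The any-place twin of ★ p01 `K2LiuInertCartanVolumes.exists_cartanVolumeDatum_inert`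
(which needs `v` unramified, a `σ`-fixed uniformiser and an INTEGRAL frame): here `w ∣ v` is any place fixed by `c` (inert or ramified, any residue characteristic),
`ϖ` ANY uniformiser of `L_w`, `T ∈ GL₂(L_w)` ANY frame of the place form (`diag(dV)_w = σ_w(T)ᵀ·antidiag(1,1)·T`).

**`exists_cartanVolumeDatum_anyPlace`** — for every Haar measure `μ` on `G_v` there are a compact open `K₀ ≤ G_v` (`Ψ⁻¹(U(σ_w,J₀) ∩ GL₂(𝒪_w))` for the
one-place-model-with-frame `Ψ : G_v ≃ₜ* U(σ_w, J₀)`, ★ `localPiNonsplitEquiv` ∘ ★ `unitaryGroupOfFormCongrOfEq`), a ★ `IsCartanFamily` `tv : ℕ → G_v` for `K₀`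
(`Ψ(tv m) = diag(ϖ^m, (σϖ^m)⁻¹)`, ★ (F1)), an auxiliary ray `cv : ℕ → G_v` with `(cv i)_w = T⁻¹·diag(π^i, π^{−i})·T`, `π = ϖ·σ_wϖ` `σ_w`-FIXED (the shape of
★ (F3) `K2LiuCartanDecayFrame`), a central unit `z ∈ K₀` with `tv(2i) = cv i · z^i`, `tv(2i+1) = tv 1 · (cv i · z^i)`, and constants `C₁ ≥ 0`, `Q = q_w = #𝓀[L_w]`
with **`μ(K₀ · tv m · K₀) ≤ C₁ · Q^m`** for all `m` — ★ (F2a) cover by `2·#net` cosets + ★ (F2b) `#net ≤ D·q_w^m` + left invariance.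
Theorems only; no `def`, no `sorry`, default heartbeats.  [BruhatTits1972, (4.4.3)–(4.4.4)]; [Macdonald1971, Ch. V §3]; [Tits1979, §3.3.3]; [Serre1979, Ch. V §3].
HONEST LABEL: HC_CM is proved only modulo the 7 printed citations (2 remaining named inputs: hLiu418 = stmt-HodgeConjecture-24832, h413 =
stmt-HodgeConjecture-24833) until rung 0 closes; count-neutral helper toward #32dR (organ (26-r)), retires nothing by itself.
-/

set_option autoImplicit false
-- the mandated namespace repeats the single-problem summit's segment (`HodgeConjecture.HodgeConjecture`)
set_option linter.dupNamespace false

noncomputable section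

open scoped Matrix ENNReal Valued WithZero
open NumberField IsDedekindDomain Matrix MeasureTheory

namespace Summit.HodgeConjecture.HodgeConjecture.Cruxes.HLiu418.K2LiuCartanVolumeDatumAnyPlace

open Literature.NumberTheory.Automorphic Literature.NumberTheory.Automorphic.UnitaryGroup Literature.NumberTheory.Automorphic.HermitianLattice
open Literature.NumberTheory.GaloisRepresentations
open Literature.NumberTheory.GelbartRogawski1991 Literature.NumberTheory.GelbartRogawski1991.GRConstruction
open Literature.NumberTheory.K2Lit.SiegelDoubled
open Summit.HodgeConjecture.HodgeConjecture.Cruxes.HLiu418.K2LiuRankOneCartanAnyPlace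
open Summit.HodgeConjecture.HodgeConjecture.Cruxes.HLiu418.K2LiuRankOneCosetCoverAnyPlace
open Summit.HodgeConjecture.HodgeConjecture.Cruxes.HLiu418.K2LiuAntifixedLatticeIndex
open Summit.HodgeConjecture.HodgeConjecture.Cruxes.HLiu418.K2LiuSplitCosetCount

variable (L : Type) [Field L] [NumberField L] [IsCMField L]
variable (dV : Fin 2 → L) (v : HeightOneSpectrum (𝓞 (Fp L)))

omit [IsCMField L] in
/-- `v_w(2) = exp(−t)` for some `t ∈ ℕ` (`2 = 1 + 1` is integral and non-zero in characteristic `0`). [folklore] -/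
theorem exists_valued_two (w : HeightOneSpectrum (𝓞 L)) : ∃ t : ℕ, Valued.v (2 : w.adicCompletion L) = WithZero.exp (-(t : ℤ)) := by
  haveI : CharZero (w.adicCompletion L) := charZero_of_injective_algebraMap (algebraMap L (w.adicCompletion L)).injective
  have hle : Valued.v (2 : w.adicCompletion L) ≤ 1 := by
    rw [show (2 : w.adicCompletion L) = 1 + 1 by norm_num]
    exact Valuation.map_add_le _ (by rw [Valuation.map_one]) (by rw [Valuation.map_one])
  have hne : Valued.v (2 : w.adicCompletion L) ≠ 0 := (Valuation.ne_zero_iff _).2 two_ne_zero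
  refine ⟨(-WithZero.log (Valued.v (2 : w.adicCompletion L))).toNat, ?_⟩
  have h1 : WithZero.log (Valued.v (2 : w.adicCompletion L)) ≤ 0 := by
    rw [← WithZero.exp_log hne, ← WithZero.exp_zero, WithZero.exp_le_exp] at hle; exact hle
  rw [Int.toNat_of_nonneg (by omega), neg_neg, WithZero.exp_log hne]

set_option maxHeartbeats 400000 in -- as ★ `K2LiuInertCartanVolumes.exists_cartanVolumeDatum_inert` (measured 2026-09-04): 200000 times out at `whnf` on the `localPi` datum; 400000 passes
/-- **THE RANK-ONE CARTAN VOLUME DATUM OF `U(diag dV)(L⁺_v)` AT ANY NON-SPLIT PLACE WITH A RATIONAL HYPERBOLIC FRAME.**  See the module docstring.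
[cite: BruhatTits1972, (4.4.3)] [cite: Macdonald1971, Ch. V §3] [cite: Tits1979, §3.3.3] [cite: Serre1979, Ch. V §3] -/
theorem exists_cartanVolumeDatum_anyPlace (w : UnitaryGroup.PlacesOver L v) (hw : IsCMField.complexConj L • w.1 = w.1)
    {ϖ : w.1.adicCompletion L} (hϖ : Valued.v ϖ = WithZero.exp (-1 : ℤ))
    (T : GL (Fin 2) (w.1.adicCompletion L))
    (hTJ : UnitaryGroup.placeForm (Matrix.diagonal dV) w.1 =
      formCongr (galAdicCompletionMap (L := L) (IsCMField.complexConj L) hw) T ((StdForm.antidiagonal 2).over (w.1.adicCompletion L)))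
    [MeasurableSpace (UnitaryGroup.localPi L (IsCMField.complexConj L) 2 (Matrix.diagonal dV) v)]
    [BorelSpace (UnitaryGroup.localPi L (IsCMField.complexConj L) 2 (Matrix.diagonal dV) v)]
    (μ : Measure (UnitaryGroup.localPi L (IsCMField.complexConj L) 2 (Matrix.diagonal dV) v)) [μ.IsHaarMeasure] :
    ∃ (K₀ : Subgroup (UnitaryGroup.localPi L (IsCMField.complexConj L) 2 (Matrix.diagonal dV) v))
      (tv cv : ℕ → UnitaryGroup.localPi L (IsCMField.complexConj L) 2 (Matrix.diagonal dV) v)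
      (z : UnitaryGroup.localPi L (IsCMField.complexConj L) 2 (Matrix.diagonal dV) v) (C₁ Q : ℝ),
      IsOpen (K₀ : Set (UnitaryGroup.localPi L (IsCMField.complexConj L) 2 (Matrix.diagonal dV) v)) ∧
      IsCompact (K₀ : Set (UnitaryGroup.localPi L (IsCMField.complexConj L) 2 (Matrix.diagonal dV) v)) ∧
      IsCartanFamily K₀ tv ∧ Q = (Nat.card 𝓀[w.1.adicCompletion L] : ℝ) ∧ 0 ≤ C₁ ∧ z ∈ K₀ ∧
      (∀ i, Units.val ((cv i : UnitaryGroup.LocalGLPi L 2 v) w) =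
        ((T⁻¹ : GL (Fin 2) (w.1.adicCompletion L)) : Matrix (Fin 2) (Fin 2) (w.1.adicCompletion L)) *
          Matrix.diagonal ![(ϖ * galAdicCompletionMap (L := L) (IsCMField.complexConj L) hw ϖ) ^ i,
            ((ϖ * galAdicCompletionMap (L := L) (IsCMField.complexConj L) hw ϖ) ^ i)⁻¹] * (T : Matrix (Fin 2) (Fin 2) (w.1.adicCompletion L))) ∧
      (∀ i, tv (2 * i) = cv i * z ^ i) ∧ (∀ i, tv (2 * i + 1) = tv 1 * (cv i * z ^ i)) ∧
      (∀ m, (μ (DoubleCoset.doubleCoset (tv m) (K₀ : Set _) K₀)).toReal ≤ C₁ * Q ^ m) := by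
  classical
  haveI : Algebra.IsQuadraticExtension (Fp L) L := IsCMField.isQuadraticExtension L
  have hc : IsCMField.complexConj L ≠ 1 := IsCMField.complexConj_ne_one L
  have hcc : IsCMField.complexConj L * IsCMField.complexConj L = 1 := AlgEquiv.ext fun x => IsCMField.complexConj_apply_apply L x
  haveI : Finite 𝓀[w.1.adicCompletion L] := finite_residueField_adicCompletion L w.1
  -- the conjugation `σ` of `L_w`: an isometric involution, not the identity
  set σ : w.1.adicCompletion L →+* w.1.adicCompletion L := galAdicCompletionMap (L := L) (IsCMField.complexConj L) hw with hσ
  have hσσ : ∀ x, σ (σ x) = x := Liu2021.galAdicCompletionMap_galAdicCompletionMap_self (Fp L) L (IsCMField.complexConj L) hcc hw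
  have hvσ : ∀ x, Valued.v (σ x) = Valued.v x := fun x => valued_galAdicCompletionMap (L := L) (IsCMField.complexConj L) hw x
  have hne : ∃ x, σ x ≠ x := Liu2021.exists_galAdicCompletionMap_ne (Fp L) L (IsCMField.complexConj L) hc hw
  obtain ⟨t, h2⟩ := exists_valued_two L w.1
  have hϖ0 : ϖ ≠ 0 := ne_zero_of_v_eq_exp hϖ
  have hσϖ0 : σ ϖ ≠ 0 := map_ne_zero_of_vσ hvσ hϖ0
  -- `Ψ : G_v ≃ₜ* U(σ, J₀)`, `u ↦ T u_w T⁻¹`; `K = U(σ,J₀) ∩ GL₂(𝒪_w)`, `K₀ = Ψ⁻¹ K`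
  -- (`Ψ` is introduced as an opaque local constant with its one defining property, so that no later step unfolds the one-place model)
  obtain ⟨Ψ, hΨ⟩ : ∃ Ψ : UnitaryGroup.localPi L (IsCMField.complexConj L) 2 (Matrix.diagonal dV) v ≃ₜ*
      unitaryGroupOfForm σ ((StdForm.antidiagonal 2).over (w.1.adicCompletion L)),
      ∀ u, ((Ψ u : unitaryGroupOfForm σ ((StdForm.antidiagonal 2).over (w.1.adicCompletion L))) : GL (Fin 2) (w.1.adicCompletion L)) =
        T * (u : UnitaryGroup.LocalGLPi L 2 v) w * T⁻¹ :=
    ⟨(localPiNonsplitEquiv (IsCMField.complexConj L) (Matrix.diagonal dV) hc w hw).trans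
      (unitaryGroupOfFormCongrOfEq σ T ((StdForm.antidiagonal 2).over (w.1.adicCompletion L)) _ hTJ.symm), fun u => rfl⟩
  set K : Subgroup (unitaryGroupOfForm σ ((StdForm.antidiagonal 2).over (w.1.adicCompletion L))) :=
    unitaryInt σ ((StdForm.antidiagonal 2).over (w.1.adicCompletion L)) with hK
  have hKo : IsOpen (K : Set (unitaryGroupOfForm σ ((StdForm.antidiagonal 2).over (w.1.adicCompletion L)))) :=
    isOpen_unitaryInt_adicCompletion (IsCMField.complexConj L) v w hw _
  have hKc : IsCompact (K : Set (unitaryGroupOfForm σ ((StdForm.antidiagonal 2).over (w.1.adicCompletion L)))) :=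
    isCompact_unitaryInt_adicCompletion (IsCMField.complexConj L) v w hw _
  have hΨc : Continuous (Ψ.toMulEquiv : UnitaryGroup.localPi L (IsCMField.complexConj L) 2 (Matrix.diagonal dV) v →
      unitaryGroupOfForm σ ((StdForm.antidiagonal 2).over (w.1.adicCompletion L))) := map_continuous Ψ
  have hΨsc : Continuous (Ψ.toMulEquiv.symm : unitaryGroupOfForm σ ((StdForm.antidiagonal 2).over (w.1.adicCompletion L)) →
      UnitaryGroup.localPi L (IsCMField.complexConj L) 2 (Matrix.diagonal dV) v) := map_continuous Ψ.symm
  let K₀ : Subgroup (UnitaryGroup.localPi L (IsCMField.complexConj L) 2 (Matrix.diagonal dV) v) := K.comap Ψ.toMulEquiv.toMonoidHom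
  have hKK : ∀ x, Ψ.toMulEquiv x ∈ K ↔ x ∈ K₀ := fun x => by rw [Subgroup.mem_comap, MulEquiv.coe_toMonoidHom]
  have hK₀set : (K₀ : Set (UnitaryGroup.localPi L (IsCMField.complexConj L) 2 (Matrix.diagonal dV) v)) = Ψ.toMulEquiv ⁻¹' (K : Set _) :=
    Set.ext fun x => (hKK x).symm.trans Set.mem_preimage.symm
  have hK₀o : IsOpen (K₀ : Set (UnitaryGroup.localPi L (IsCMField.complexConj L) 2 (Matrix.diagonal dV) v)) := by
    rw [hK₀set]; exact hKo.preimage hΨc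
  have hK₀c : IsCompact (K₀ : Set (UnitaryGroup.localPi L (IsCMField.complexConj L) 2 (Matrix.diagonal dV) v)) := by
    have himg : (K₀ : Set (UnitaryGroup.localPi L (IsCMField.complexConj L) 2 (Matrix.diagonal dV) v)) = Ψ.toMulEquiv.symm '' (K : Set _) := by
      rw [hK₀set]
      ext x
      constructor
      · intro hx
        exact ⟨Ψ.toMulEquiv x, Set.mem_preimage.1 hx, Ψ.toMulEquiv.symm_apply_apply x⟩
      · rintro ⟨y, hy, rfl⟩
        refine Set.mem_preimage.2 ?_
        rw [MulEquiv.apply_symm_apply]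
        exact hy
    rw [himg]
    exact hKc.image hΨsc
  -- the `w`-component of `Ψ⁻¹ y` is `T⁻¹ y T`
  have hΨw : ∀ y : unitaryGroupOfForm σ ((StdForm.antidiagonal 2).over (w.1.adicCompletion L)),
      ((Ψ.toMulEquiv.symm y : UnitaryGroup.localPi L (IsCMField.complexConj L) 2 (Matrix.diagonal dV) v) : UnitaryGroup.LocalGLPi L 2 v) w =
        T⁻¹ * (y : GL (Fin 2) (w.1.adicCompletion L)) * T := by
    intro y
    have h := hΨ (Ψ.toMulEquiv.symm y)
    rw [show Ψ (Ψ.toMulEquiv.symm y) = y from Ψ.toMulEquiv.apply_symm_apply y] at h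
    rw [h]; group
  -- the ★ (F1) family `b_m = diag(ϖ^m, (σϖ^m)⁻¹)`, the σ-fixed ray `c_i = diag(π^i, π^{−i})`, `π = ϖσϖ`, and the central unit `z = (ϖ∕σϖ)·1`
  obtain ⟨b, hb⟩ := exists_cartanFamily_two hσσ hvσ hϖ0
  set π : w.1.adicCompletion L := ϖ * σ ϖ with hπ
  have hσπ : σ π = π := by rw [hπ, map_mul, hσσ, mul_comm]
  have hπ0 : π ≠ 0 := mul_ne_zero hϖ0 hσϖ0
  have hcU : ∀ i : ℕ, ∃ cU : unitaryGroupOfForm σ ((StdForm.antidiagonal 2).over (w.1.adicCompletion L)),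
      ((cU : GL (Fin 2) (w.1.adicCompletion L)) : Matrix (Fin 2) (Fin 2) (w.1.adicCompletion L)) = Matrix.diagonal ![π ^ i, (π ^ i)⁻¹] := by
    intro i
    obtain ⟨cU, hcU⟩ := exists_coe_eq_diagonal_pair hσσ hvσ (pow_ne_zero i hπ0)
    refine ⟨cU, ?_⟩
    rw [hcU, map_pow, hσπ]
  choose cU hcU' using hcU
  set u : w.1.adicCompletion L := ϖ * (σ ϖ)⁻¹ with hu
  have hu0 : u ≠ 0 := mul_ne_zero hϖ0 (inv_ne_zero hσϖ0)
  have hσu : σ u * u = 1 := by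
    rw [hu, map_mul, map_inv₀, hσσ]; field_simp
  have hvu : Valued.v u = 1 := by
    rw [hu, map_mul, map_inv₀, hvσ, mul_inv_cancel₀ ((Valuation.ne_zero_iff _).2 hϖ0)]
  let zU : unitaryGroupOfForm σ ((StdForm.antidiagonal 2).over (w.1.adicCompletion L)) :=
    ⟨Units.map (Matrix.scalar (Fin 2) : w.1.adicCompletion L →+* Matrix (Fin 2) (Fin 2) (w.1.adicCompletion L)).toMonoidHom (Units.mk0 u hu0),
      scalar_mem_unitaryGroupOfForm σ _ (Units.mk0 u hu0) hσu⟩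
  have hzU : ((zU : GL (Fin 2) (w.1.adicCompletion L)) : Matrix (Fin 2) (Fin 2) (w.1.adicCompletion L)) = Matrix.diagonal fun _ => u := by
    change (Matrix.scalar (Fin 2)) u = _
    rw [Matrix.scalar_apply]
  have hzUK : zU ∈ K := by
    refine (mem_unitaryInt_iff_forall_v_le_one hvσ).2 fun i j => ?_
    rw [hzU]
    by_cases hij : i = j
    · subst hij; rw [Matrix.diagonal_apply_eq, hvu]
    · rw [Matrix.diagonal_apply_ne _ hij, map_zero]; exact zero_le
  -- relations in `U(σ, J₀)`: `b(2i) = c_i · z^i`, `b(2i+1) = b 1 · b(2i)`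
  have hzUpow : ∀ i : ℕ, (((zU ^ i : unitaryGroupOfForm σ ((StdForm.antidiagonal 2).over (w.1.adicCompletion L))) : GL (Fin 2) (w.1.adicCompletion L)) :
      Matrix (Fin 2) (Fin 2) (w.1.adicCompletion L)) = Matrix.diagonal fun _ => u ^ i := by
    intro i
    rw [Subgroup.coe_pow, Units.val_pow_eq_pow_val, hzU, Matrix.diagonal_pow]
    rfl
  have hrel1 : ∀ i : ℕ, b (2 * i) = cU i * zU ^ i := by
    intro i
    apply Subtype.ext; apply Units.ext
    rw [hb, Subgroup.coe_mul, Units.val_mul, hcU', hzUpow, Matrix.diagonal_mul_diagonal]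
    congr 1
    funext j
    fin_cases j
    · simp only [Fin.zero_eta, Fin.isValue, Matrix.cons_val_zero, hπ, hu]
      rw [← mul_pow, pow_mul, mul_mul_mul_comm, mul_inv_cancel₀ hσϖ0, mul_one, sq]
    · simp only [Fin.mk_one, Fin.isValue, Matrix.cons_val_one, Matrix.cons_val_fin_one, hπ, hu, map_pow]
      have e1 : ((ϖ * σ ϖ) ^ i)⁻¹ * (ϖ * (σ ϖ)⁻¹) ^ i = ((σ ϖ)⁻¹ * (σ ϖ)⁻¹) ^ i := by
        rw [← inv_pow, ← mul_pow, mul_inv, mul_mul_mul_comm, inv_mul_cancel₀ hϖ0, one_mul]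
      rw [e1, ← inv_pow, pow_mul, sq]
  have hrel2 : ∀ i : ℕ, b (2 * i + 1) = b 1 * b (2 * i) := by
    intro i
    apply Subtype.ext; apply Units.ext
    rw [hb, Subgroup.coe_mul, Units.val_mul, hb, hb, Matrix.diagonal_mul_diagonal]
    congr 1
    funext j
    fin_cases j
    · simp [pow_succ, mul_comm]
    · simp only [Fin.mk_one, Fin.isValue, Matrix.cons_val_one, Matrix.cons_val_fin_one, map_pow, pow_one]
      rw [pow_succ, mul_inv, mul_comm]
  -- the transported family
  let tv : ℕ → UnitaryGroup.localPi L (IsCMField.complexConj L) 2 (Matrix.diagonal dV) v := fun m => Ψ.toMulEquiv.symm (b m)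
  let cv : ℕ → UnitaryGroup.localPi L (IsCMField.complexConj L) 2 (Matrix.diagonal dV) v := fun i => Ψ.toMulEquiv.symm (cU i)
  let z : UnitaryGroup.localPi L (IsCMField.complexConj L) 2 (Matrix.diagonal dV) v := Ψ.toMulEquiv.symm zU
  have hcart : IsCartanFamily K₀ tv := isCartanFamily_of_mulEquiv Ψ.toMulEquiv hKK (isCartanFamily_unitaryInt_two hσσ hvσ hϖ b hb)
  have hz : z ∈ K₀ := (hKK z).1 (by rw [MulEquiv.apply_symm_apply]; exact hzUK)
  have hcvw : ∀ i, Units.val ((cv i : UnitaryGroup.LocalGLPi L 2 v) w) =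
      ((T⁻¹ : GL (Fin 2) (w.1.adicCompletion L)) : Matrix (Fin 2) (Fin 2) (w.1.adicCompletion L)) * Matrix.diagonal ![π ^ i, (π ^ i)⁻¹] *
        (T : Matrix (Fin 2) (Fin 2) (w.1.adicCompletion L)) := by
    intro i
    rw [hΨw, Units.val_mul, Units.val_mul, hcU']
  have hsymm_mul : ∀ x y : unitaryGroupOfForm σ ((StdForm.antidiagonal 2).over (w.1.adicCompletion L)),
      Ψ.toMulEquiv.symm (x * y) = Ψ.toMulEquiv.symm x * Ψ.toMulEquiv.symm y := fun x y => map_mul Ψ.toMulEquiv.symm x y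
  have hsymm_pow : ∀ (x : unitaryGroupOfForm σ ((StdForm.antidiagonal 2).over (w.1.adicCompletion L))) (i : ℕ),
      Ψ.toMulEquiv.symm (x ^ i) = Ψ.toMulEquiv.symm x ^ i := fun x i => map_pow Ψ.toMulEquiv.symm x i
  have htv2 : ∀ i, tv (2 * i) = cv i * z ^ i := by
    intro i
    change Ψ.toMulEquiv.symm (b (2 * i)) = Ψ.toMulEquiv.symm (cU i) * Ψ.toMulEquiv.symm zU ^ i
    rw [hrel1 i, hsymm_mul, hsymm_pow]
  have htv21 : ∀ i, tv (2 * i + 1) = tv 1 * (cv i * z ^ i) := by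
    intro i
    rw [← htv2]
    change Ψ.toMulEquiv.symm (b (2 * i + 1)) = Ψ.toMulEquiv.symm (b 1) * Ψ.toMulEquiv.symm (b (2 * i))
    rw [hrel2 i, hsymm_mul]
  -- the volume bound: ★ (F2b) index, ★ (F2a) cover, left invariance
  obtain ⟨D, hD, hDj⟩ := exists_relIndex_antifixedBall_le (K := w.1.adicCompletion L) hσσ hvσ hϖ h2 hne
  have hμK : μ (K₀ : Set _) ≠ ∞ := hK₀c.measure_lt_top.ne
  have hvol : ∀ m, μ (DoubleCoset.doubleCoset (tv m) (K₀ : Set _) K₀) ≤ ((2 * D * Nat.card 𝓀[w.1.adicCompletion L] ^ m : ℕ) : ℝ≥0∞) * μ (K₀ : Set _) := by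
    intro m
    -- the net of the anti-fixed integers modulo `v ≤ exp(−2m)` and the cover in `U(σ, J₀)`
    obtain ⟨R₀, hR₀card, hR₀S, hR₀net⟩ := exists_net_of_relIndex_ne_zero
      ((Valued.v : Valuation (w.1.adicCompletion L) ℤᵐ⁰).leAddSubgroup 1 ⊓ (AddMonoidHom.id (w.1.adicCompletion L) + σ.toAddMonoidHom).ker)
      ((Valued.v : Valuation (w.1.adicCompletion L) ℤᵐ⁰).leAddSubgroup (WithZero.exp (-(2 * (m : ℤ)))) ⊓
        (AddMonoidHom.id (w.1.adicCompletion L) + σ.toAddMonoidHom).ker) (hDj m).1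
    have hR₀ : ∀ ρ ∈ R₀, Valued.v ρ ≤ 1 ∧ σ ρ = -ρ := by
      intro ρ hρ
      obtain ⟨h1, h2'⟩ := AddSubgroup.mem_inf.1 (hR₀S ρ hρ)
      exact ⟨Valuation.mem_leAddSubgroup_iff.1 h1, eq_neg_of_add_eq_zero_right ((mem_ker_id_add_iff _).1 h2')⟩
    have hnet : ∀ ρ : w.1.adicCompletion L, Valued.v ρ ≤ 1 → σ ρ = -ρ → ∃ ρ' ∈ R₀, Valued.v (ρ - ρ') ≤ WithZero.exp (-(2 * (m : ℤ))) := by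
      intro ρ hρ1 hρσ
      obtain ⟨ρ', hρ', hmem⟩ := hR₀net ρ (AddSubgroup.mem_inf.2 ⟨Valuation.mem_leAddSubgroup_iff.2 hρ1,
        (mem_ker_id_add_iff _).2 (by rw [hρσ, add_neg_cancel])⟩)
      exact ⟨ρ', hρ', Valuation.mem_leAddSubgroup_iff.1 (AddSubgroup.mem_inf.1 hmem).1⟩
    obtain ⟨R, hRcard, hcover⟩ := doubleCoset_subset_biUnion_cosets hσσ hvσ (v_pow_eq hϖ m) (hb m) R₀ hR₀ hnet
    -- pull the cover back along `Ψ`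
    have hset : DoubleCoset.doubleCoset (tv m) (K₀ : Set _) K₀ ⊆ ⋃ r ∈ R, (fun y => (Ψ.toMulEquiv.symm (r * b m))⁻¹ * y) ⁻¹' (K₀ : Set _) := by
      intro x hx
      have hx' : Ψ.toMulEquiv x ∈ DoubleCoset.doubleCoset (b m) (K : Set _) K := (mem_doubleCoset_symm_iff Ψ.toMulEquiv hKK (b m) x).1 hx
      have hx'' := hcover hx'
      simp only [Set.mem_iUnion, Set.mem_preimage, SetLike.mem_coe] at hx'' ⊢
      obtain ⟨r, hrR, hr⟩ := hx''
      refine ⟨r, hrR, (hKK _).1 ?_⟩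
      rw [map_mul, map_inv, MulEquiv.apply_symm_apply]
      exact hr
    calc μ (DoubleCoset.doubleCoset (tv m) (K₀ : Set _) K₀)
        ≤ μ (⋃ r ∈ R, (fun y => (Ψ.toMulEquiv.symm (r * b m))⁻¹ * y) ⁻¹' (K₀ : Set _)) := measure_mono hset
      _ ≤ ∑ r ∈ R, μ ((fun y => (Ψ.toMulEquiv.symm (r * b m))⁻¹ * y) ⁻¹' (K₀ : Set _)) := measure_biUnion_finset_le _ _
      _ = ∑ r ∈ R, μ (K₀ : Set _) := Finset.sum_congr rfl fun r _ => measure_preimage_mul μ _ _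
      _ = (R.card : ℝ≥0∞) * μ (K₀ : Set _) := by rw [Finset.sum_const, nsmul_eq_mul]
      _ ≤ ((2 * D * Nat.card 𝓀[w.1.adicCompletion L] ^ m : ℕ) : ℝ≥0∞) * μ (K₀ : Set _) := by
          refine mul_le_mul_left ?_ _
          exact_mod_cast hRcard.trans ((Nat.mul_le_mul_left 2 hR₀card).trans (by
            have := (hDj m).2; nlinarith [this]))
  refine ⟨K₀, tv, cv, z, 2 * D * (μ (K₀ : Set _)).toReal, (Nat.card 𝓀[w.1.adicCompletion L] : ℝ), hK₀o, hK₀c, hcart, rfl, by positivity, hz, hcvw,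
    htv2, htv21, fun m => ?_⟩
  have h := ENNReal.toReal_mono (ENNReal.mul_ne_top ENNReal.coe_ne_top hμK |> fun h => by exact_mod_cast h) (hvol m)
  rw [ENNReal.toReal_mul] at h
  refine h.trans (le_of_eq ?_)
  rw [ENNReal.toReal_natCast]
  push_cast
  ring

end Summit.HodgeConjecture.HodgeConjecture.Cruxes.HLiu418.K2LiuCartanVolumeDatumAnyPlace

end
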